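import Summits.Schanuel.Schanuel.Theorems.DiophantineDichotomyKhovanskiiApproxTypeEvDefs
import Summits.Schanuel.Schanuel.Theorems.DiophantineDichotomyKhovanskiiApproxTypeEvLWMeasure
import HarnessLib

/-!
# Route `DiophantineDichotomy`, crux `KhovanskiiApproxTypeEv`, line `anchored-reduction`:
# the crux is EQUIVALENT to the conjunction of the two open stubs

Crux `Summit.Schanuel.Schanuel.Theses.DiophantineDichotomy.KhovanskiiApproxTypeEv`
(item stmt-Schanuel-14972), line `anchored-reduction` (skeleton `Cruxes/KhovanskiiApproxTypeEv/
Lines/Sketch.lean` v5).  With the Lindemann–Weierstrass layer `stub_evLW_two : EvLWTwo` LANDED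
unconditionally (p123471, after Ably 1994 was discharged in Literature, p121092), the crux as filed
is EQUIVALENT — not merely implied by — the conjunction of the skeleton's two remaining registered
stubs `EvNonLWTwo ∧ EvRankThreeUp`.  So handing the two stubs back as crux-sized items loses nothing
and adds nothing: they ARE the crux, split along the honest case distinction
`n = 2 ∧ s ∉ ℚ̄²` / `n ≥ 3`.

## Contents (implications and one equivalence; nothing is credited to the summit)

* `evNonLWTwo_of_ev`, `evRankThreeUp_of_ev` — the crux restricts to each open layer;
* `ev_of_stubs` — the skeleton's composition (`khovanskiiApproxTypeEv_iff` + the landed LW layer);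
* `khovanskiiApproxTypeEv_iff_stubs : KhovanskiiApproxTypeEv ↔ (EvNonLWTwo ∧ EvRankThreeUp)`
  (registered sub-goal).
-/

noncomputable section

-- `Summit.Schanuel.Schanuel.…` is the mandated summit/sub-problem namespace (single-conjunct summit), hence:
set_option linter.dupNamespace false

namespace Summit.Schanuel.Schanuel.Cruxes.KhovanskiiApproxTypeEv.AnchoredReduction

open Summit.Schanuel.Schanuel.Theses.DiophantineDichotomy (KhovanskiiApproxTypeEv)
open Summit.Schanuel.Schanuel.Cruxes.KhovanskiiApproxType.LwSmallHeight (IsFreeKhovanskii)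

/-- The crux restricts to its non-Lindemann–Weierstrass layer at `n = 2` (`1/(2−1) = 1`). [folklore] -/
theorem evNonLWTwo_of_ev (hEv : KhovanskiiApproxTypeEv) : EvNonLWTwo := by
  intro s hs hfree _htr
  obtain ⟨a, b, C, ha, hAT⟩ := khovanskiiApproxTypeEv_iff.1 hEv 2 s le_rfl hs hfree
  refine ⟨a, b, C, ?_, hAT⟩
  have h1 : (1 : ℝ) / (((2 : ℕ) : ℝ) - 1) = 1 := by norm_num
  rwa [h1] at ha

/-- The crux restricts to its layer of ranks `n ≥ 3`. [folklore] -/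
theorem evRankThreeUp_of_ev (hEv : KhovanskiiApproxTypeEv) : EvRankThreeUp :=
  fun n s hn hs hfree => khovanskiiApproxTypeEv_iff.1 hEv n s (by omega) hs hfree

/-- The two open stubs give the crux (the skeleton's composition: landed LW layer `stub_evLW_two`
at the algebraic points of `ℂ²`, `EvNonLWTwo` at the others, `EvRankThreeUp` for `n ≥ 3`). [folklore] -/
theorem ev_of_stubs (hN : EvNonLWTwo) (hR : EvRankThreeUp) : KhovanskiiApproxTypeEv := by
  refine khovanskiiApproxTypeEv_iff.2 fun n s hn hli hfree => ?_
  by_cases h3 : 3 ≤ n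
  · exact hR n s h3 hli hfree
  obtain rfl : n = 2 := by omega
  have key : ∃ a b C : ℝ, a < 1 ∧ ApproxTypeEvAt 2 s a b C := by
    by_cases halg : ∀ i, IsAlgebraic ℚ (s i)
    · exact stub_evLW_two s halg hli
    · push Not at halg
      exact hN s hli hfree halg
  obtain ⟨a, b, C, ha, hat⟩ := key
  refine ⟨a, b, C, ?_, hat⟩
  have h1 : (1 : ℝ) / (((2 : ℕ) : ℝ) - 1) = 1 := by norm_num
  rwa [h1]

/-- **Registered sub-goal `khovanskiiApproxTypeEv_iff_stubs` — the crux IS the conjunction of the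
two open stubs.** Given the landed Lindemann–Weierstrass layer (p123471), `KhovanskiiApproxTypeEv`
is equivalent to `EvNonLWTwo ∧ EvRankThreeUp`: promoting the two stubs to items re-files the crux
along the case split `n = 2, s ∉ ℚ̄²` / `n ≥ 3` with no loss and no gain. [folklore] -/
theorem khovanskiiApproxTypeEv_iff_stubs : KhovanskiiApproxTypeEv ↔ (EvNonLWTwo ∧ EvRankThreeUp) :=
  ⟨fun h => ⟨evNonLWTwo_of_ev h, evRankThreeUp_of_ev h⟩, fun h => ev_of_stubs h.1 h.2⟩

end Summit.Schanuel.Schanuel.Cruxes.KhovanskiiApproxTypeEv.AnchoredReduction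

end
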